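import Summits.CriticalPhenomena.PercolationContinuityZ3.Theorems.PercNearOneGluingNoHeavyLowerTailTerminalTwoSumPointwise
import Summits.CriticalPhenomena.PercolationContinuityZ3.Theorems.PercNearOneGluingNoHeavyLowerTailApexTwoSumSums
import HarnessLib

/-!
# `NoHeavyLowerTail` (stmt-CriticalPhenomena-4575) — 2-sums through a terminal (the `{b, v}`-cut), part 4:
# the dictionary — cell masses of the glued measure as bilinear forms in the blocks' `{v,b}`-wired masses

Support file (prover prim-gen-kcluster gen 72; `--supports stmt-CriticalPhenomena-4575`).  No definitions, no named facts, no sorries.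
`X_i = Σ_η rcWeightW wX q {v,b} η · 1_{x_i}(η)` (`x1 = {b,v ∈ C(a)}`, `x2 = {b ∈ C(a), v ∉}`, `x3 = {v ∈ C(a), b ∉}`), `Y_σ` = the `{v,b}`-wired masses
of the six cells of `(v; b, c)` in `DY`; `K = q^{k^T(∅)}`.  DICTIONARY (validated numerically, HOME/code/gen72/bvcut_check.py):
`K·Zφ(T) = X1Yt + X1Yuc + X1Yua + X2Yt + X3Yt + qX2Yua`, `K·Zφ(U_b) = X1Yub + X1Ys + X1Yn + X2Yub + qX2Yuc + qX2Ys + qX2Yn + X3Yub`,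
`K·Zφ(U_c) = qX3Yuc`, `K·Zφ(S) = qX3Ys` (the last under `c ∈ cl DY b`).
-/

noncomputable section

namespace Summit.CriticalPhenomena.PercolationContinuityZ3.Theorems

namespace TerminalTwoSum

open Finset SimpleGraph Literature.Probability.Percolation Literature.Probability.Percolation.Gladkov
open Literature.Probability.Percolation.BHK2006 (weight)
open Literature.Probability.Percolation.DecisionTree (ind ind_of_mem ind_of_not_mem ind_nonneg)
open Literature.Probability.LatticeModels RefinedRowR3 ThreePointLB MeasureTheory
open scoped Classical

variable {V : Type*} [Fintype V]

section Sums

variable {DX DY : Finset (Sym2 V)} {a b c v : V} (hab : a ≠ b) (hav : a ≠ v) (hac : a ≠ c) (hbc : b ≠ c) (hvc : v ≠ c)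
  (hvb : v ≠ b)
  (hsepD : ∀ x : V, (∃ e ∈ DX, x ∈ e) → (∃ e ∈ DY, x ∈ e) → (x = v ∨ x = b))
  (haY : ∀ e ∈ DY, a ∉ e) (hcX : ∀ e ∈ DX, c ∉ e)
  (w wX wY : Sym2 V → unitInterval) (q : ℝ) (hw : ∀ e, e ∉ (↑DX ∪ ↑DY : Set (Sym2 V)) → (w e : ℝ) = 0)
  (hX : ∀ e ∈ (↑DX : Set (Sym2 V)), wX e = w e) (hX' : ∀ e ∉ (↑DX : Set (Sym2 V)), wX e = 0)
  (hY : ∀ e ∈ (↑DX : Set (Sym2 V)), wY e = 0) (hY' : ∀ e ∉ (↑DX : Set (Sym2 V)), wY e = w e)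
include hab hav hac hbc hvc hvb hsepD haY hcX hw hX hX' hY hY'

/-- **Dictionary, cell `T`.** [this work] -/
theorem glued_T_sum :
    (∑ ω : BondConfig V, rcWeightW w q ∅ ω * ind {η : BondConfig V | b ∈ cl η.toFinset a ∧ c ∈ cl η.toFinset a} ω) * q ^ clusterCount (∅ : BondConfig V) ({v, b} : Set V) =
      (∑ η : BondConfig V, rcWeightW wX q ({v, b} : Set V) η * ind {η : BondConfig V | b ∈ cl η.toFinset a ∧ v ∈ cl η.toFinset a} η) * (∑ η : BondConfig V, rcWeightW wY q ({v, b} : Set V) η * ind {η : BondConfig V | b ∈ cl η.toFinset v ∧ c ∈ cl η.toFinset v} η) + (∑ η : BondConfig V, rcWeightW wX q ({v, b} : Set V) η * ind {η : BondConfig V | b ∈ cl η.toFinset a ∧ v ∈ cl η.toFinset a} η) * (∑ η : BondConfig V, rcWeightW wY q ({v, b} : Set V) η * ind {η : BondConfig V | b ∉ cl η.toFinset v ∧ c ∈ cl η.toFinset v} η) + (∑ η : BondConfig V, rcWeightW wX q ({v, b} : Set V) η * ind {η : BondConfig V | b ∈ cl η.toFinset a ∧ v ∈ cl η.toFinset a}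 η) * (∑ η : BondConfig V, rcWeightW wY q ({v, b} : Set V) η * ind {η : BondConfig V | b ∉ cl η.toFinset v ∧ c ∉ cl η.toFinset v ∧ c ∈ cl η.toFinset b} η) + (∑ η : BondConfig V, rcWeightW wX q ({v, b} : Set V) η * ind {η : BondConfig V | b ∈ cl η.toFinset a ∧ v ∉ cl η.toFinset a} η) * (∑ η : BondConfig V, rcWeightW wY q ({v, b} : Set V) η * ind {η : BondConfig V | b ∈ cl η.toFinset v ∧ c ∈ cl η.toFinset v} η) + (∑ η : BondConfig V, rcWeightW wX q ({v, b} : Set V) η * ind {η : BondConfig V | b ∉ cl η.toFinset a ∧ v ∈ cl η.toFinset a} η) * (∑ η : BondConfig V, rcWeightW wY q ({v, b} : Set V) η * ind {η : BondConfig V | b ∈ cl η.toFinset v ∧ c ∈ cl η.toFinset v} η) + q * ((∑ η : BondConfig V, rcWeightW wX q ({v, b} : Set V) η * ind {η : BondConfig V | b ∈ cl η.toFinset a ∧ v ∉ cl η.toFinset a} η) * (∑ η : BondConfig V, rcWeightW wY q ({v, b} : Set V) η * ind {η : BondConfig V | b ∉ cl η.toFinset v ∧ c ∉ cl η.toFinset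 v ∧ c ∈ cl η.toFinset b} η)) := by
  rw [Finset.sum_mul, Finset.sum_congr rfl fun ω _ => pt_T hab hav hac hbc hvc hvb hsepD haY hcX w q hw ω]
  have e1 := ApexTwoSum.sum_weight_blocks_rc w wX wY (↑DX) hX hX' hY hY' q ({v, b} : Set V) (fun x => ind {η : BondConfig V | b ∈ cl η.toFinset a ∧ v ∈ cl η.toFinset a} x) (fun y => ind {η : BondConfig V | b ∈ cl η.toFinset v ∧ c ∈ cl η.toFinset v} y)
  have e2 := ApexTwoSum.sum_weight_blocks_rc w wX wY (↑DX) hX hX' hY hY' q ({v, b} : Set V) (fun x => ind {η : BondConfig V | b ∈ cl η.toFinset a ∧ v ∈ cl η.toFinset a} x) (fun y => ind {η : BondConfig V | b ∉ cl η.toFinset v ∧ c ∈ cl η.toFinset v} y)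
  have e3 := ApexTwoSum.sum_weight_blocks_rc w wX wY (↑DX) hX hX' hY hY' q ({v, b} : Set V) (fun x => ind {η : BondConfig V | b ∈ cl η.toFinset a ∧ v ∈ cl η.toFinset a} x) (fun y => ind {η : BondConfig V | b ∉ cl η.toFinset v ∧ c ∉ cl η.toFinset v ∧ c ∈ cl η.toFinset b} y)
  have e4 := ApexTwoSum.sum_weight_blocks_rc w wX wY (↑DX) hX hX' hY hY' q ({v, b} : Set V) (fun x => ind {η : BondConfig V | b ∈ cl η.toFinset a ∧ v ∉ cl η.toFinset a} x) (fun y => ind {η : BondConfig V | b ∈ cl η.toFinset v ∧ c ∈ cl η.toFinset v} y)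
  have e5 := ApexTwoSum.sum_weight_blocks_rc w wX wY (↑DX) hX hX' hY hY' q ({v, b} : Set V) (fun x => ind {η : BondConfig V | b ∉ cl η.toFinset a ∧ v ∈ cl η.toFinset a} x) (fun y => ind {η : BondConfig V | b ∈ cl η.toFinset v ∧ c ∈ cl η.toFinset v} y)
  have e6 := ApexTwoSum.sum_weight_blocks_rc w wX wY (↑DX) hX hX' hY hY' q ({v, b} : Set V) (fun x => ind {η : BondConfig V | b ∈ cl η.toFinset a ∧ v ∉ cl η.toFinset a} x) (fun y => ind {η : BondConfig V | b ∉ cl η.toFinset v ∧ c ∉ cl η.toFinset v ∧ c ∈ cl η.toFinset b} y)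
  beta_reduce at e1 e2 e3 e4 e5 e6
  rw [← e1, ← e2, ← e3, ← e4, ← e5, ← e6]
  simp only [Finset.mul_sum]
  rw [← Finset.sum_add_distrib, ← Finset.sum_add_distrib, ← Finset.sum_add_distrib, ← Finset.sum_add_distrib, ← Finset.sum_add_distrib]
  refine Finset.sum_congr rfl fun ω _ => by ring

/-- **Dictionary, cell `U_b`.** [this work] -/
theorem glued_Ub_sum :
    (∑ ω : BondConfig V, rcWeightW w q ∅ ω * ind {η : BondConfig V | b ∈ cl η.toFinset a ∧ c ∉ cl η.toFinset a} ω) * q ^ clusterCount (∅ : BondConfig V) ({v, b} : Set V) =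
      (∑ η : BondConfig V, rcWeightW wX q ({v, b} : Set V) η * ind {η : BondConfig V | b ∈ cl η.toFinset a ∧ v ∈ cl η.toFinset a} η) * (∑ η : BondConfig V, rcWeightW wY q ({v, b} : Set V) η * ind {η : BondConfig V | b ∈ cl η.toFinset v ∧ c ∉ cl η.toFinset v} η) + (∑ η : BondConfig V, rcWeightW wX q ({v, b} : Set V) η * ind {η : BondConfig V | b ∈ cl η.toFinset a ∧ v ∈ cl η.toFinset a} η) * (∑ η : BondConfig V, rcWeightW wY q ({v, b} : Set V) η * ind {η : BondConfig V | b ∉ cl η.toFinset v ∧ c ∉ cl η.toFinset v ∧ Sep DY (cl η.toFinset v) b c} η) + (∑ η : BondConfig V, rcWeightW wX q ({v, b} : Set V) η * ind {η : BondConfig V | b ∈ cl η.toFinset a ∧ v ∈ cl η.toFinset a} η) * (∑ η : BondConfig V, rcWeightW wY q ({v, b} : Set V) η * ind {η : BondConfig V | b ∉ cl η.toFinset v ∧ c ∉ cl η.toFinset v ∧ c ∉ cl η.toFinset b ∧ ¬ Sep DY (cl η.toFinset v) b c} η) + (∑ η : BondConfig V, rcWeightW wX q ({v, b} : Set V) η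 * ind {η : BondConfig V | b ∈ cl η.toFinset a ∧ v ∉ cl η.toFinset a} η) * (∑ η : BondConfig V, rcWeightW wY q ({v, b} : Set V) η * ind {η : BondConfig V | b ∈ cl η.toFinset v ∧ c ∉ cl η.toFinset v} η) + q * ((∑ η : BondConfig V, rcWeightW wX q ({v, b} : Set V) η * ind {η : BondConfig V | b ∈ cl η.toFinset a ∧ v ∉ cl η.toFinset a} η) * (∑ η : BondConfig V, rcWeightW wY q ({v, b} : Set V) η * ind {η : BondConfig V | b ∉ cl η.toFinset v ∧ c ∈ cl η.toFinset v} η)) + q * ((∑ η : BondConfig V, rcWeightW wX q ({v, b} : Set V) η * ind {η : BondConfig V | b ∈ cl η.toFinset a ∧ v ∉ cl η.toFinset a} η) * (∑ η : BondConfig V, rcWeightW wY q ({v, b} : Set V) η * ind {η : BondConfig V | b ∉ cl η.toFinset v ∧ c ∉ cl η.toFinset v ∧ Sep DY (cl η.toFinset v) b c} η)) + q * ((∑ η : BondConfig V, rcWeightW wX q ({v, b} : Set V) η * ind {η : BondConfig V | b ∈ cl η.toFinset a ∧ v ∉ cl η.toFinset a} η) * (∑ η : BondConfig V, rcWeightW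 wY q ({v, b} : Set V) η * ind {η : BondConfig V | b ∉ cl η.toFinset v ∧ c ∉ cl η.toFinset v ∧ c ∉ cl η.toFinset b ∧ ¬ Sep DY (cl η.toFinset v) b c} η)) + (∑ η : BondConfig V, rcWeightW wX q ({v, b} : Set V) η * ind {η : BondConfig V | b ∉ cl η.toFinset a ∧ v ∈ cl η.toFinset a} η) * (∑ η : BondConfig V, rcWeightW wY q ({v, b} : Set V) η * ind {η : BondConfig V | b ∈ cl η.toFinset v ∧ c ∉ cl η.toFinset v} η) := by
  rw [Finset.sum_mul, Finset.sum_congr rfl fun ω _ => pt_Ub hab hav hac hbc hvc hvb hsepD haY hcX w q hw ω]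
  have e1 := ApexTwoSum.sum_weight_blocks_rc w wX wY (↑DX) hX hX' hY hY' q ({v, b} : Set V) (fun x => ind {η : BondConfig V | b ∈ cl η.toFinset a ∧ v ∈ cl η.toFinset a} x) (fun y => ind {η : BondConfig V | b ∈ cl η.toFinset v ∧ c ∉ cl η.toFinset v} y)
  have e2 := ApexTwoSum.sum_weight_blocks_rc w wX wY (↑DX) hX hX' hY hY' q ({v, b} : Set V) (fun x => ind {η : BondConfig V | b ∈ cl η.toFinset a ∧ v ∈ cl η.toFinset a} x) (fun y => ind {η : BondConfig V | b ∉ cl η.toFinset v ∧ c ∉ cl η.toFinset v ∧ Sep DY (cl η.toFinset v) b c} y)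
  have e3 := ApexTwoSum.sum_weight_blocks_rc w wX wY (↑DX) hX hX' hY hY' q ({v, b} : Set V) (fun x => ind {η : BondConfig V | b ∈ cl η.toFinset a ∧ v ∈ cl η.toFinset a} x) (fun y => ind {η : BondConfig V | b ∉ cl η.toFinset v ∧ c ∉ cl η.toFinset v ∧ c ∉ cl η.toFinset b ∧ ¬ Sep DY (cl η.toFinset v) b c} y)
  have e4 := ApexTwoSum.sum_weight_blocks_rc w wX wY (↑DX) hX hX' hY hY' q ({v, b} : Set V) (fun x => ind {η : BondConfig V | b ∈ cl η.toFinset a ∧ v ∉ cl η.toFinset a} x) (fun y => ind {η : BondConfig V | b ∈ cl η.toFinset v ∧ c ∉ cl η.toFinset v} y)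
  have e5 := ApexTwoSum.sum_weight_blocks_rc w wX wY (↑DX) hX hX' hY hY' q ({v, b} : Set V) (fun x => ind {η : BondConfig V | b ∈ cl η.toFinset a ∧ v ∉ cl η.toFinset a} x) (fun y => ind {η : BondConfig V | b ∉ cl η.toFinset v ∧ c ∈ cl η.toFinset v} y)
  have e6 := ApexTwoSum.sum_weight_blocks_rc w wX wY (↑DX) hX hX' hY hY' q ({v, b} : Set V) (fun x => ind {η : BondConfig V | b ∈ cl η.toFinset a ∧ v ∉ cl η.toFinset a} x) (fun y => ind {η : BondConfig V | b ∉ cl η.toFinset v ∧ c ∉ cl η.toFinset v ∧ Sep DY (cl η.toFinset v) b c} y)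
  have e7 := ApexTwoSum.sum_weight_blocks_rc w wX wY (↑DX) hX hX' hY hY' q ({v, b} : Set V) (fun x => ind {η : BondConfig V | b ∈ cl η.toFinset a ∧ v ∉ cl η.toFinset a} x) (fun y => ind {η : BondConfig V | b ∉ cl η.toFinset v ∧ c ∉ cl η.toFinset v ∧ c ∉ cl η.toFinset b ∧ ¬ Sep DY (cl η.toFinset v) b c} y)
  have e8 := ApexTwoSum.sum_weight_blocks_rc w wX wY (↑DX) hX hX' hY hY' q ({v, b} : Set V) (fun x => ind {η : BondConfig V | b ∉ cl η.toFinset a ∧ v ∈ cl η.toFinset a} x) (fun y => ind {η : BondConfig V | b ∈ cl η.toFinset v ∧ c ∉ cl η.toFinset v} y)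
  beta_reduce at e1 e2 e3 e4 e5 e6 e7 e8
  rw [← e1, ← e2, ← e3, ← e4, ← e5, ← e6, ← e7, ← e8]
  simp only [Finset.mul_sum]
  rw [← Finset.sum_add_distrib, ← Finset.sum_add_distrib, ← Finset.sum_add_distrib, ← Finset.sum_add_distrib, ← Finset.sum_add_distrib, ← Finset.sum_add_distrib, ← Finset.sum_add_distrib]
  refine Finset.sum_congr rfl fun ω _ => by ring

/-- **Dictionary, cell `U_c`.** [this work] -/
theorem glued_Uc_sum :
    (∑ ω : BondConfig V, rcWeightW w q ∅ ω * ind {η : BondConfig V | b ∉ cl η.toFinset a ∧ c ∈ cl η.toFinset a} ω) * q ^ clusterCount (∅ : BondConfig V) ({v, b} : Set V) =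
      q * ((∑ η : BondConfig V, rcWeightW wX q ({v, b} : Set V) η * ind {η : BondConfig V | b ∉ cl η.toFinset a ∧ v ∈ cl η.toFinset a} η) * (∑ η : BondConfig V, rcWeightW wY q ({v, b} : Set V) η * ind {η : BondConfig V | b ∉ cl η.toFinset v ∧ c ∈ cl η.toFinset v} η)) := by
  rw [Finset.sum_mul, Finset.sum_congr rfl fun ω _ => pt_Uc hab hav hac hbc hvc hvb hsepD haY hcX w q hw ω]
  have e1 := ApexTwoSum.sum_weight_blocks_rc w wX wY (↑DX) hX hX' hY hY' q ({v, b} : Set V) (fun x => ind {η : BondConfig V | b ∉ cl η.toFinset a ∧ v ∈ cl η.toFinset a} x) (fun y => ind {η : BondConfig V | b ∉ cl η.toFinset v ∧ c ∈ cl η.toFinset v} y)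
  beta_reduce at e1
  rw [← e1]
  simp only [Finset.mul_sum]
  refine Finset.sum_congr rfl fun ω _ => by ring

/-- **Dictionary, separating cell `S`** (under `c ∈ cl DY b`). [this work] -/
theorem glued_S_sum (HY : c ∈ cl DY b) :
    (∑ ω : BondConfig V, rcWeightW w q ∅ ω * ind {η : BondConfig V | b ∉ cl η.toFinset a ∧ c ∉ cl η.toFinset a ∧ Sep (DX ∪ DY) (cl η.toFinset a) b c} ω) * q ^ clusterCount (∅ : BondConfig V) ({v, b} : Set V) =
      q * ((∑ η : BondConfig V, rcWeightW wX q ({v, b} : Set V) η * ind {η : BondConfig V | b ∉ cl η.toFinset a ∧ v ∈ cl η.toFinset a} η) * (∑ η : BondConfig V, rcWeightW wY q ({v, b} : Set V) η * ind {η : BondConfig V | b ∉ cl η.toFinset v ∧ c ∉ cl η.toFinset v ∧ Sep DY (cl η.toFinset v) b c} η)) := by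
  rw [Finset.sum_mul, Finset.sum_congr rfl fun ω _ => pt_S hab hav hac hbc hvc hvb hsepD haY hcX w q hw HY ω]
  have e1 := ApexTwoSum.sum_weight_blocks_rc w wX wY (↑DX) hX hX' hY hY' q ({v, b} : Set V) (fun x => ind {η : BondConfig V | b ∉ cl η.toFinset a ∧ v ∈ cl η.toFinset a} x) (fun y => ind {η : BondConfig V | b ∉ cl η.toFinset v ∧ c ∉ cl η.toFinset v ∧ Sep DY (cl η.toFinset v) b c} y)
  beta_reduce at e1
  rw [← e1]
  simp only [Finset.mul_sum]
  refine Finset.sum_congr rfl fun ω _ => by ring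

end Sums

end TerminalTwoSum

end Summit.CriticalPhenomena.PercolationContinuityZ3.Theorems
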